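import Mathlib
import Literature.MathematicalPhysics.QuantumFieldTheory.Balaban1983to89.Setup

/-! # `Balaban1983to89.B11GaugeGlue` — the gauge-change identity and the seam-gluing of the per-cube
gauges of Theorem 1 (9) of [Balaban1985Variational], kernel-checked as pure group algebra over `GaugeGroup`

CITATION HEADER (lean-in-tree rule 2026-08-18).  T. Bałaban, *The variational problem and background fields in
renormalization group method for lattice gauge theories*, Commun. Math. Phys. **102**, 277–309 (1985)
[Balaban1985Variational] (cell paper B11; held `paper:balaban1985-cmp102-variational-background`, journal page = PDF
page + 276): p. 279 [PDF 3], the class of cubes and Theorem 1 with displays (8)–(10) — render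
`b2b-balaban-ref1/pages/1985-cmp102-variational-background/1985-cmp102-variational-background-p003-x2.png` READ AS AN
IMAGE by this seat 2026-08-19; Sect. F, p. 300 [PDF 24] (opening paragraph and (144)), p. 301 [PDF 25] ((145)–(153))
and p. 302 [PDF 26] (the sentences on A′, HB, A₁ after (157)–(158)) — renders `…-p024-x2.png`, `…-p025-x2.png`,
`…-p026-x2.png` READ AS IMAGES by this seat 2026-08-19 (v1.1).  CONTEXT ONLY (the consumer displays; nothing of them
is typed here): T. Bałaban, *Renormalization group approach to lattice gauge field theories. I*, Commun. Math. Phys.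
**109**, 249–301 (1987) [Balaban1987RG1] (cell paper B12), p. 276 [PDF 28], display (3.30) and the two sentences
after (3.31) — render `…/1987-cmp109-rg-I-small-field/1987-cmp109-rg-I-small-field-p028-x2.png` READ AS AN IMAGE by
this seat 2026-08-19; p. 273 [PDF 25] (□₀ = □̃⁵ and the sequence {□_n}) and p. 275 [PDF 27] ((3.26)–(3.27) and «We
repeat the constructions of Sect. F [15]») — renders `…-p025-x2.png`, `…-p027-x2.png` READ AS IMAGES by this seat
2026-08-19 (v1.1); B12's reference [15] IS [Balaban1985Variational] and its [14] = B11's [6] = T. Bałaban, Commun.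
Math. Phys. **99**, 75–102 (1985) (reference list p. 299 [PDF 51], render read as image).  Both papers are UNDER
ADJUDICATION by the audit cell `pub-balaban`: NOTHING printed in them is asserted here.  Every statement of this file
is an identity or inequality valid in an arbitrary group carrying the interface `GaugeGroup` of `Setup` (the five
`dist1` axioms: `dist1_nonneg`, `dist1_one`, `dist1_inv`, `dist1_conj`, `dist1_mul_le`), or integer arithmetic on
`Fin d → ℤ`; it is proved by the kernel from Mathlib and `Setup` alone.  NEW sibling module; imports only `Setup` and
Mathlib; modifies nothing.  Unit `b2b-balaban-b11-g11` (planner seat, PAPER SUB-CELL B11 gen 11; journal claim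
G-B11-GAUGE-GLUE-KERNEL); cell records: GAPS G-adv5-46 (6)(R1) (adv5-g29: «a gauge-change lemma ∣∇(u_□⁻¹u_□′)∣ ≦
O(1)·(sum of the two cubes' (9)-bounds) on overlaps — true in substance … elementary) but nowhere printed in [15] or
[6] … this is the cheapest honest repair and is the sentence the cell should file for G-adv9-7»), G-adv9-7, C-adv5-45
(2)/(4), and the rows written with this file: C-B11-G11a (this certificate), C-B11-G11b (the located PRINTED source
of the consumer's single gauge, [Balaban1985Variational] Sect. F (144)–(153) — see HONEST SCOPE (c); it corrects
G-adv5-46 (1)(b)/(4) and paragraph (c) of this header's v1), DIVERGENCE D-B11-21 (modelling conventions (i)–(vi)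
below).  v1.1 = v1 (p182781) with this module docstring corrected after Sect. F pp. 300–302 were read; every
declaration and every declaration docstring is byte-identical to v1.

WHAT IS PRINTED.  p. 279 [PDF 3] (render read as image), the class of cubes: *«More exactly we assume that □ has a
size 2MLʲη, where M is a multiple of R₁M₁, and that the cube □̃ of the size (2M + 4R₁M₁)Lʲη and with the same center
as □, is contained in Bʲ(Λ_j)∪Bʲ⁺¹(Λ_{j+1}), but not in Bʲ⁺¹(Λ_{j+1}). We consider all cubes □ satisfying the above
conditions.»*; Theorem 1, regularity clause: *«The minimal configurations U have the following regularity properties: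
for an arbitrary cube □ in the class described above, of a size 2MLʲη, M ≦ M(ε₁), there exists a gauge transformation
u defined on a neighborhood of □ and such that on □, U^{u⁻¹} = e^{iηA}, ∣A∣ < B₃Mε₁(Lʲη)⁻¹, ∣∇^ηA∣ < B₃Mε₁(Lʲη)⁻²,
‖A‖_{1,β} < B₄(β₀)Mε₁(Lʲη)^{−2−β} for 0 ≦ β ≦ β₀ = 1, (9) ∣∂^{η*}∂^ηA∣, ∣Δ^ηA∣ < B₃Mε₁(Lʲη)⁻³. (10) The constants
a₀, a₁, B₃, depend on d and L only, the constants B₄(β₀), M(ε₁) depend on the indicated parameters also. More exactly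
M(ε₁) = R₁M₁(a₁/ε₁).»*  So Theorem 1 supplies ONE gauge u = u_□ PER CUBE □, and «all cubes □ satisfying the above
conditions» are considered, in particular overlapping ones.  The consumer, [Balaban1987RG1] p. 276 (render read as
image): *«A = (1/iη) log exp iη𝐀 exp iL⁻¹ηH_{k+1}(□₀, (1/i) log V), B = Q(ηA) on □₀. (3.30)»* and *«We have similar
bounds for the function H_{k+1}(□₀, (1/i) log V), with α₂ replaced by B₃O(1)Mα₀, and □₀ by □̃⁴, see (3.27).»*, reads
the background minimiser in ONE gauge u_{k+1} on the whole cube □₀ ((3.27), p. 275: *«We make the next gauge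
transformation u_{k+1} changing the axial gauge into Landau gauge for the configuration U_{k+1}(□₀, V) … ∣u_{k+1} − 1∣
< B₃O(1)Mα₀ on □₀»*), and says how that gauge is built (p. 275, render read as image): *«We repeat the
constructions of Sect. F [15], and we introduce the same generalized axial gauge for the configuration M˙(U). … We make
the next gauge transformation u_{k+1} changing the axial gauge into Landau gauge for the configuration
U_{k+1}(□₀, V)»*.  Sect. F of [Balaban1985Variational] (the PROOF of (9)–(10)), p. 300 [PDF 24]: *«Let us take a cube
□ intersecting Ω_j but not Ω_{j+1}, of a size 2MLʲη. … For a given □ we construct the sequence of cubes {□_n}, and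
the cube □̃. Let us recall that □₀ ⊃ □₁ ⋯ ⊃ □_j ⊃ □, dist(□_{n+1}, □_n^c) = R₁M₁Lⁿη, n = 0, 1, …, j, (144) and □̃
is a cube with dist(□, □̃^c) = 2R₁M₁Lʲη. … For simplicity of notations we assume that j = k … Now we repeat all the
constructions of the Sect. F in [6]. Applying a gauge transformation to U_k we get a configuration U′_k such, that
U′_k ∈ Ax_k(□̃^{(k)}, 1), and Ū′_kᵏ satisfies the generalized axial gauge conditions on □̃^{(k)}.»*; p. 301 [PDF 25]:
*«U′_k ∈ 𝔘_k({Ω′_j}, ε₀) ∩ 𝔅_k(ℭ_k, V″) ∩ Ax_k(ℭ_k, 1), (150) where Ω′_j = □_j, j = 0, 1, …, k − 1, Ω′_k = □″_k. …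
Now we apply Theorem 2 of the paper [6] to the pair of configurations U′_k, 1 (in place of U′U₀, U₀ in that paper).
We assume that 9dL²Mε₀ ≦ c₁. Then there exists a unique gauge transformation u satisfying the restrictions ūʲ = 1
on Λ′_j, and such that U′_k^{u⁻¹} = U₁ = e^{iηA}, Lʲη∣A∣, (Lʲη)²∣∇^ηA∣, (Lʲη)³∣∂^{η*}∂^ηA∣, (Lʲη)³∣Δ^ηA∣ <
9dL²B₁Mε₀ on Ω′_j, j = 0, 1, …, k; (152) R∂^{η*}A = 0, (153)»*; p. 302 [PDF 26]: *«The configuration A′ satisfies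
(152) with 36 instead of 9 on the right-hand side. … The configurations HB and A₁ satisfy (152) with the bounds
4dL²B₁Mε₀ and 40dL²B₁Mε₀ correspondingly.»*  So the proof of Theorem 1 DOES print, for every cube □ of the class,
ONE gauge u on the whole nested sequence {□_n} (144) filling □̃, in which the minimiser (after the generalized axial
gauge) has a logarithm bounded on EVERY layer Ω′_n = □_n with that layer's scale weight (Lⁿη) and ONE constant
9dL²B₁Mε₀ — M being the size of □ in its own scale units — together with the Landau-type condition (153); the
statement (9) is its restriction to □.  [Balaban1987RG1] (3.27) invokes exactly this construction with □̃ ↦ □₀ =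
□̃⁵ and {□_n} ↦ the sequence of p. 273 *«satisfying the conditions (1.3)–(1.6) [14] (with k + 1, L⁻¹η instead of
k, η, R = R₁), hence □̃⁴ ⊂ □_{k+1}»*.  Consequently NO gluing of per-cube gauges is needed for the far datum of
(3.30) off □̃⁴: (152) bounds it layer by layer in the single gauge u_{k+1} (whether B12's sequence and constants
meet the hypotheses of [6] Thm 2 as used on p. 301 — 9dL²Mε₀ ≦ c₁ with the plaquette smallness of U_{k+1}(□₀, V)
— is the consumer lineages' bookkeeping, GAPS C-B11-G11b).  What this file kernel-checks is the group algebra of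
comparing and patching two such gauges — the lemma (R1) that the cell's repair text for G-adv9-7 names — and what
patching per-cube gauges would cost if one did NOT use Sect. F's single gauge.

WHAT IS KERNEL-CHECKED (namespace `…Balaban1983to89.B11GaugeGlue`; `G` any `[GaugeGroup G]`, sites `X` any type,
`U : X → X → G` a transporter on ORDERED PAIRS, gauge transformations `u : X → G`).
 §1 `dist1` toolkit: `dist1_conj_inv` (∣h⁻¹gh − 1∣ = ∣g − 1∣), `dist1_inv_mul_eq` (∣a⁻¹b − 1∣ = ∣ab⁻¹ − 1∣),
    `dist1_telescope` (∣a₀aₙ⁻¹ − 1∣ ≤ Σ_{i<n} ∣aᵢaᵢ₊₁⁻¹ − 1∣) and `dist1_telescope_const` (≤ n·δ).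
 §2 `rep u U x y := (u x)⁻¹ · U x y · u y` = the bond variables `U^{u⁻¹}` of (9) (tree convention B7 (8)
    `GaugeField.gaugeAct v U b = v b.src · U b · (v b.tgt)⁻¹` with `v = u⁻¹`: bridge `gaugeAct_inv_apply`);
    `rep_one`, `rep_mul` (composition of gauges), `rep_rev`/`dist1_rep_rev` (reversed pair when `U y x = (U x y)⁻¹`).
 §3 THE GAUGE-CHANGE IDENTITY = (R1) of G-adv5-46 in group form.  `trans u' u x := (u' x)⁻¹ · u x` (the transition
    function w = u′⁻¹u between two gauges); `rep_eq_conj_trans : rep u' U x y = w x · rep u U x y · (w y)⁻¹` (exact: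
    the two representatives of the SAME configuration differ by the pure gauge w); `dist1_trans_mul_inv_le :
    dist1 (w x · (w y)⁻¹) ≤ dist1 (rep u' U x y) + dist1 (rep u U x y)` — w is covariantly almost constant: its
    lattice derivative along the pair (x, y) is bounded by the SUM of the two small-field sizes (reader-level Lie-algebra
    form: (1/iη)·w∇^ηw⁻¹ on the bond, bounded by ∣A_□∣ + ∣A_□′∣ once ∣e^{iηA} − 1∣ ≤ η∣A∣ is granted, HONEST SCOPE
    (b)); along a chain of pairs `dist1_trans_path_le` / `dist1_trans_path_le_const` (≤ n·(β′ + β): w is within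
    n(β′ + β) of a CONSTANT on a set of pair-diameter n — the quantitative reason why gluing two cube gauges by a
    constant is useless at the continuum limit: n ~ 2dMLʲ bonds across a cube, so n·ηB₃Mε₁(Lʲη)⁻¹ does not vanish
    with η).
 §4 SEAM GLUING BY A RETRACTION.  For `π : X → X` (think: a retraction of the new cube's neighbourhood onto the region
    R = Fix π where the old gauge is kept), `glue u' v π x := u' x · w (π x)`, w = trans u' v — the new cube's gauge u′
    twisted by the transition function TRANSPORTED ALONG π (`trans_glue : trans u' (glue u' v π) = w ∘ π`).  Proved:
    `glue_of_fix` (ũ = v on Fix π), `rep_glue` (rep ũ U x y = w(πx)⁻¹ · rep u' U x y · w(πy), exact),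
    `rep_glue_of_fix` (both endpoints fixed ⇒ rep ũ = rep v, exact), `dist1_rep_glue_le` / `dist1_rep_glue_le₃` :
      dist1 (rep ũ U x y) ≤ dist1 (rep u' U x y) + dist1 (rep u' U (πx) (πy)) + dist1 (rep v U (πx) (πy)),
    `dist1_rep_glue_of_collapse` (πx = πy ⇒ ≤ dist1 (rep u' U x y)), and the sup form `dist1_rep_glue_le_of_bounds`:
    if ∣rep u′∣ ≤ β′ on a pair set S′ and ∣rep v∣ ≤ b on T, then on every pair of S′ whose π-image is in S′ ∩ T or
    collapses, ∣rep ũ∣ ≤ 2β′ + b.  ONE FORMULA, NO CASE SPLIT AT THE SEAM: the seam term is the transition function at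
    the landing pair and vanishes where π collapses the pair.
 §5 CHAINS.  `chainGauge u π` (ũ₀ = u₀, ũₙ₊₁ = glue uₙ₊₁ ũₙ πₙ), the controlled pair sets `chainCtrl S π` (stage n+1:
    pairs fixed by πₙ and controlled at stage n, or pairs of Sₙ₊₁ whose πₙ-image is in Sₙ₊₁ and controlled at stage n
    or collapses), `chainBound β` (b₀ = β₀, bₙ₊₁ = bₙ + 2βₙ₊₁; closed form `chainBound_eq_sum`: bₙ = β₀ + 2Σ_{1≤i≤n} βᵢ)
    and the theorem `chain_bound : chainCtrl S π n x y → dist1 (rep (ũ n) U x y) ≤ chainBound β n`; persistence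
    `chainGauge_of_fix` / `chainGauge_rep_of_fix` (a site / pair fixed by every πₘ, i ≤ m < n, keeps its stage-i gauge /
    representative EXACTLY — so a pair first controlled at stage i carries bᵢ for ever, not bₙ).  Scalar corollaries:
    `sum_le_of_geometric_growth` and `chainBound_le_of_geometric_growth` (RADIAL regime, coarse → fine: L·βᵢ ≤ βᵢ₊₁ with
    1 < L ⇒ bₙ ≤ β₀ + 2(L/(L−1))βₙ ≤ (1 + 2L/(L−1))·βₙ — k-UNIFORM: every layer carries O(1) times ITS OWN (9)-bound,
    O(1) = 1 + 2L/(L−1) ≤ 5 for L ≥ 2), and `chainBound_const` (TANGENTIAL regime, βᵢ ≡ β: bₙ = (2n + 1)β — LINEAR in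
    the length of the gluing chain; see HONEST SCOPE (c)).
 §6 A CONCRETE RETRACTION.  On `Fin d → ℤ`: the coordinatewise clamp `clamp lo hi` into the box [lo, hi] —
    `clamp_mem`, `clamp_of_mem`, `clamp_coord_eq`, `clamp_mono_coord`, `abs_clamp_sub_le` (1-Lipschitz in every
    coordinate) and `clamp_nbr` (a lattice bond (x, x + e_μ) is mapped to a bond or collapsed) — so for a box-shaped
    kept region the hypotheses of §4 are met by bonds: the landing pair of a bond is a bond of the box or a point.

READING / MODELLING CONVENTIONS (DIVERGENCE D-B11-21).  (i) CURRENCY: everything is stated with `dist1` = ∣· − 1∣ at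
GROUP level (B7 (19)); the Lie-algebra sizes ∣A∣ of (9) enter only through the reader-level dictionary ∣e^{iηA} − 1∣ ≤
η∣A∣ and, backwards, ∣(1/iη) log g∣ ≤ (π/2)η⁻¹∣g − 1∣ for unitary g with ∣g − 1∣ < √2 (principal logarithm) — neither
is formalised here (no matrix model is fixed by `GaugeGroup`, DIVERGENCE F4).  (ii) ORDERED PAIRS: `U : X → X → G` is a
transporter on all ordered pairs (bonds, reversed bonds via `rep_rev`, or holonomies along chosen paths); which pairs
are «bonds of □» is carried by the pair sets S, T of §4–§5, never by the type.  (iii) «u defined on a neighborhood of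
□» ↦ a total function `u : X → G` whose representative is only CLAIMED small on the pair set S (values elsewhere are
never used: `rep_glue` reads the old gauge only on Fix π).  (iv) The glued gauge is NOT a Landau gauge: no condition
D*A = 0 and no ∇^ηA / Hölder control is transported across a seam — only the sup size ∣rep − 1∣; (9)'s second and
third members and (10) are NOT glued by this file.  (v) `U^{u⁻¹}` of (9) ↦ `rep u U` (u⁻¹ on the left, u on the
right), matching `GaugeField.gaugeAct` of `Setup` with v = u⁻¹ (`gaugeAct_inv_apply`).  (vi) §6 uses corner
coordinates lo ≤ hi of a box in ℤᵈ; B12's centred cubes are boxes, nothing depends on the centring.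

HONEST SCOPE.  (a) What (R1) of G-adv5-46 asks is §3 verbatim at group level, and it is a TRIVIALITY of group
algebra (five lines); its value is only that the cell's repair sentence for G-adv9-7 now has a kernel referent with
the exact constant: the SUM of the two (9)-bounds per bond, no O(1).  (b) The Lie-algebra form «∣(1/iη)w∇^ηw⁻¹∣ ≤
∣A_□∣ + ∣A_□′∣» needs (i)'s dictionary and is reader-level.  (c) NOT NEEDED BY THE CONSUMER AS A GLUING, AND WHY
(GAPS C-B11-G11b): v1 of this header called the single-gauge all-layer statement «in ONE gauge on □₀, ∣(1/iη) log
U_{k+1}(□₀, V)∣ ≤ B₃O(1)Mα₀(Lⁿη)⁻¹ on the layer-n bonds, every n, O(1) independent of k» unprinted; that was WRONG: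
it is printed, inside the proof of Theorem 1, as [Balaban1985Variational] Sect. F (144) + (150)–(153) (quoted under
WHAT IS PRINTED) — one gauge u on the nested sequence {□_n} filling □̃, bounds (152) on every Ω′_n = □_n with the
weight (Lⁿη), its ∇^η, ∂^{η*}∂^η, Δ^η members included, constant 9dL²B₁Mε₀ with ONE M, and (153) — and
[Balaban1987RG1] p. 275 builds u_{k+1} by «We repeat the constructions of Sect. F [15]» with □̃ ↦ □₀.  Hence GAPS
G-adv5-46 (1)(b) («No statement of [15] gives an absolute Landau-gauge logarithm of the full minimiser in a single
gauge on a region spanning more than two layers») and (4) («the single gauge u_{k+1} on □₀ is itself unsupported by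
any theorem of [15] … would carry on Λ_n … a factor L^{k+1−n}») are corrected by C-B11-G11b: not a numbered theorem,
but the displayed construction of Sect. F, with NO factor L^{k+1−n} ((152) carries the same constant on every layer;
the M in it is the top-scale size, as in (145) «4d(M + R₁M₁)L²ε₀ ≦ 8dL²Mε₀»).  What remains for the consumer is
bookkeeping, not a missing lemma: (α) B12's sequence {□_n} of p. 273 satisfies (1.3)–(1.6) of [14] = [6] with R = R₁,
the class (144) has gaps exactly R₁M₁Lⁿη — [6] Thm 2 is stated for general admissible sequences, to be confirmed at
the consumer's constants (9dL²Mε₀ ≦ c₁ with ε₀ ↦ the plaquette smallness behind (3.26)); (β) the Hölder member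
‖·‖_{1,β} of (3.27)/(10) is not displayed in (152) but belongs to the conclusion (1.36) of [6] Thm 2 («‖A‖_{1,β} <
B₂(β₀)s(Lʲη)^{−2−β} on Ω_j», tree `B8.Thm2Printed`, field `C136`), so it comes with the same application; Sect. F
pp. 303–305 (not re-read by this seat; lineage rows C-B11-F1/F4, G-B11-F3/F5) finish (9)–(10) on □; (γ) [6] Thm 2
itself is the cited fact `B8.Thm2Printed` of the tree (statement level; its uniqueness clause rests on GAPS
G-B8-05), unproved there.  The gluing accounting of §4–§5 therefore answers a
DIFFERENT question — what patching the per-cube gauges of (9) WITHOUT Sect. F's construction would cost: (c1)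
radially nothing k-dependent (coarse → fine, O(1) = 1 + 2L/(L−1), `chainBound_le_of_geometric_growth`); (c2)
tangentially (2m + 1)β along a chain of m same-scale cubes (`chainBound_const`), so patching must be organised by
depth (connected blob grown from the innermost cube; finitely many colour classes of pairwise non-adjacent cubes per
radial ring) — prose only; (c3) seams with non-box kept regions need a retraction with a Lipschitz constant Λ > 1
(§6's clamp covers boxes) — not formalised; (c4) an abelian continuum Stokes check (constant curvature f across a
layer of thickness W forces sup∣A∣ ≥ f·W/4 on a spanning loop in ANY gauge) shows that only the ratio W/(cube size),
O(1) in the geometry (144), can enter a single-gauge sup bound — consistent with (152).  None of (c1)–(c4) is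
load-bearing for [Balaban1987RG1] once Sect. F is read; they are kept as the exact accounting behind the elementary
lemma (R1).  (d) No
smallness is used anywhere: all bounds are additive consequences of the triangle inequality `dist1_mul_le` and hold
for arbitrary sizes.  (e) PRIOR ART: the content is the lattice, group-level form of the transition-function identity
of gauge patching (continuum: dg_{αβ} = g_{αβ}A_β − A_α g_{αβ} on overlaps of a cover by small-connection gauges, as
in K. Uhlenbeck, Commun. Math. Phys. 83, 31–42 (1982), doi:10.1007/bf01947069 — NOT HELD by the cell's corpus,
section number unverified; presearch: corpus fts+vec and galaxy, no held text states the lattice lemma) — hence every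
declaration is tagged [folklore]; nothing here is new mathematics.  Value = kernel certificate of an elementary
lemma (R1) that the cell's repair text for G-adv9-7 relies on (elementary, not displayed in [15] or [6]) + the
exact accounting (radial k-uniform / tangential linear) of gauge patching + (v1.1) the located PRINTED source of the
consumer's single gauge (Sect. F (144)–(153)); NOT summit progress. -/

namespace Literature.MathematicalPhysics.QuantumFieldTheory.Balaban1983to89.B11GaugeGlue

open scoped BigOperators

variable {G : Type*} [GaugeGroup G]

/-! ## §1. `dist1` toolkit -/

section DistOne

/-- `∣h⁻¹ g h − 1∣ = ∣g − 1∣` (conjugation invariance of `dist1`, inverse on the left). [folklore] -/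
theorem dist1_conj_inv (g h : G) : dist1 (h⁻¹ * g * h) = dist1 g := by
  simpa using GaugeGroup.dist1_conj g h⁻¹

/-- `∣a⁻¹ b − 1∣ = ∣a b⁻¹ − 1∣` (since `a⁻¹b = a⁻¹ (b a⁻¹) a` is a conjugate of `(a b⁻¹)⁻¹`). [folklore] -/
theorem dist1_inv_mul_eq (a b : G) : dist1 (a⁻¹ * b) = dist1 (a * b⁻¹) := by
  have h : a⁻¹ * b = a⁻¹ * (b * a⁻¹) * a := by group
  rw [h, dist1_conj_inv, ← GaugeGroup.dist1_inv (b * a⁻¹), mul_inv_rev, inv_inv]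

/-- `∣b a⁻¹ − 1∣ = ∣a b⁻¹ − 1∣`. [folklore] -/
theorem dist1_mul_inv_comm (a b : G) : dist1 (b * a⁻¹) = dist1 (a * b⁻¹) := by
  rw [← GaugeGroup.dist1_inv (b * a⁻¹), mul_inv_rev, inv_inv]

/-- Telescoping: `∣a₀ aₙ⁻¹ − 1∣ ≤ Σ_{i<n} ∣aᵢ aᵢ₊₁⁻¹ − 1∣` (from `a₀aₙ₊₁⁻¹ = (a₀aₙ⁻¹)(aₙaₙ₊₁⁻¹)` and
`dist1_mul_le`). [folklore] -/
theorem dist1_telescope (a : ℕ → G) (n : ℕ) :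
    dist1 (a 0 * (a n)⁻¹) ≤ ∑ i ∈ Finset.range n, dist1 (a i * (a (i + 1))⁻¹) := by
  induction n with
  | zero => simp [GaugeGroup.dist1_one]
  | succ n ih =>
    rw [Finset.sum_range_succ]
    have h : a 0 * (a (n + 1))⁻¹ = (a 0 * (a n)⁻¹) * (a n * (a (n + 1))⁻¹) := by group
    rw [h]
    exact (GaugeGroup.dist1_mul_le _ _).trans (add_le_add ih le_rfl)

/-- Telescoping with a uniform step bound: `n` steps of size `≤ δ` give `≤ n·δ`. [folklore] -/
theorem dist1_telescope_const (a : ℕ → G) (n : ℕ) (δ : ℝ)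
    (h : ∀ i, i < n → dist1 (a i * (a (i + 1))⁻¹) ≤ δ) :
    dist1 (a 0 * (a n)⁻¹) ≤ n * δ := by
  refine (dist1_telescope a n).trans ?_
  calc ∑ i ∈ Finset.range n, dist1 (a i * (a (i + 1))⁻¹) ≤ ∑ _i ∈ Finset.range n, δ :=
        Finset.sum_le_sum fun i hi => h i (Finset.mem_range.mp hi)
    _ = n * δ := by simp

end DistOne

/-! ## §2. Representatives of a configuration in a gauge -/

section Rep

variable {X : Type*}

/-- `rep u U x y = (u x)⁻¹ · U(x, y) · u y`: the pair variables of the configuration `U` in the gauge `u⁻¹`, i.e. the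
field written `U^{u⁻¹} = e^{iηA}` in Theorem 1 (9) (tree convention B7 (8): `U^{v}(x, y) = v(x) U(x, y) v(y)⁻¹`, here
`v = u⁻¹`). [folklore] -/
def rep (u : X → G) (U : X → X → G) (x y : X) : G := (u x)⁻¹ * U x y * u y

/-- Unfolding `rep`. [folklore] -/
theorem rep_apply (u : X → G) (U : X → X → G) (x y : X) : rep u U x y = (u x)⁻¹ * U x y * u y := rfl

/-- The trivial gauge changes nothing. [folklore] -/
theorem rep_one (U : X → X → G) : rep (fun _ => (1 : G)) U = U := by
  funext x y; simp [rep]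

/-- Composition of gauges: the representative in the gauge `(u·v)⁻¹` is the representative of `rep u U` in the
gauge `v⁻¹`. [folklore] -/
theorem rep_mul (u v : X → G) (U : X → X → G) :
    rep (fun x => u x * v x) U = rep v (rep u U) := by
  funext x y; simp [rep, mul_inv_rev, mul_assoc]

/-- Reversed pair: if `U(y, x) = U(x, y)⁻¹` then `rep u U y x = (rep u U x y)⁻¹`. [folklore] -/
theorem rep_rev (u : X → G) (U : X → X → G) (x y : X) (hU : U y x = (U x y)⁻¹) :
    rep u U y x = (rep u U x y)⁻¹ := by
  simp [rep, hU, mul_inv_rev, mul_assoc]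

/-- Reversed pair, sizes: `∣rep u U y x − 1∣ = ∣rep u U x y − 1∣` when `U(y, x) = U(x, y)⁻¹`. [folklore] -/
theorem dist1_rep_rev (u : X → G) (U : X → X → G) (x y : X) (hU : U y x = (U x y)⁻¹) :
    dist1 (rep u U y x) = dist1 (rep u U x y) := by
  rw [rep_rev u U x y hU, GaugeGroup.dist1_inv]

/-- Bridge to the tree's bond-indexed convention (`Setup`, B7 (8)): for a gauge field `U` on the positively oriented
bonds of `T^{(j)}` and a gauge transformation `u`, the field `U^{u⁻¹}` of Theorem 1 (9) is
`gaugeAct (u⁻¹) U b = (u b.src)⁻¹ · U b · u b.tgt`, i.e. `rep u` evaluated on the ordered pair `(b.src, b.tgt)` of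
any pair-transporter extending `U`. [cite: Balaban1985Averaging, (8) p.19] -/
theorem gaugeAct_inv_apply {P : Params} {j : ℕ} (u : GaugeTransf P j G) (U : GaugeField P j G) (b : PBond P j) :
    GaugeField.gaugeAct (fun x => (u x)⁻¹) U b = (u b.src)⁻¹ * U b * u b.tgt := by
  simp [GaugeField.gaugeAct]

end Rep

/-! ## §3. The gauge-change identity (two gauges, one configuration) -/

section Trans

variable {X : Type*}

/-- The transition function `w = u′⁻¹ u` between two gauges: `trans u' u x = (u' x)⁻¹ · u x`. [folklore] -/
def trans (u' u : X → G) (x : X) : G := (u' x)⁻¹ * u x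

/-- Unfolding `trans`. [folklore] -/
theorem trans_apply (u' u : X → G) (x : X) : trans u' u x = (u' x)⁻¹ * u x := rfl

/-- `trans u u = 1`. [folklore] -/
theorem trans_self (u : X → G) : trans u u = fun _ => 1 := by
  funext x; simp [trans]

/-- THE GAUGE-CHANGE IDENTITY (exact): the representatives of the SAME configuration in two gauges differ by the pure
gauge `w = u′⁻¹u`: `rep u' U x y = w x · rep u U x y · (w y)⁻¹`. [folklore] -/
theorem rep_eq_conj_trans (u' u : X → G) (U : X → X → G) (x y : X) :
    rep u' U x y = trans u' u x * rep u U x y * (trans u' u y)⁻¹ := by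
  simp only [rep, trans]; group

/-- THE GAUGE-CHANGE LEMMA ((R1) of GAPS G-adv5-46, group form): the transition function `w = u′⁻¹u` between two
gauges of one configuration is covariantly almost constant — `∣w(x) w(y)⁻¹ − 1∣ ≤ ∣rep u' U x y − 1∣ +
∣rep u U x y − 1∣` for every ordered pair (reader-level Lie-algebra form: `∣(1/iη) w ∇^η w⁻¹∣ ≤ ∣A_□′∣ + ∣A_□∣` on
the bond, once `∣e^{iηA} − 1∣ ≤ η∣A∣` is granted). Proof: `w x (w y)⁻¹ = rep u' U x y · (w y · (rep u U x y)⁻¹ ·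
(w y)⁻¹)`, triangle inequality, conjugation and inversion invariance. [folklore] -/
theorem dist1_trans_mul_inv_le (u' u : X → G) (U : X → X → G) (x y : X) :
    dist1 (trans u' u x * (trans u' u y)⁻¹) ≤ dist1 (rep u' U x y) + dist1 (rep u U x y) := by
  have h1 : trans u' u x * (trans u' u y)⁻¹
      = rep u' U x y * (trans u' u y * (rep u U x y)⁻¹ * (trans u' u y)⁻¹) := by
    simp only [rep, trans]; group
  rw [h1]
  refine (GaugeGroup.dist1_mul_le _ _).trans ?_
  rw [GaugeGroup.dist1_conj, GaugeGroup.dist1_inv]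

/-- The same with the other order `∣w(x)⁻¹ w(y) − 1∣`. [folklore] -/
theorem dist1_trans_inv_mul_le (u' u : X → G) (U : X → X → G) (x y : X) :
    dist1 ((trans u' u x)⁻¹ * trans u' u y) ≤ dist1 (rep u' U x y) + dist1 (rep u U x y) := by
  rw [dist1_inv_mul_eq]; exact dist1_trans_mul_inv_le u' u U x y

/-- Along a chain of pairs `γ 0, γ 1, …, γ n`: `∣w(γ₀) w(γₙ)⁻¹ − 1∣ ≤ Σ_{i<n} (∣rep u' U (γ i) (γ (i+1)) − 1∣ +
∣rep u U (γ i) (γ (i+1)) − 1∣)` — the transition function is within the accumulated small-field sizes of a CONSTANT.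
[folklore] -/
theorem dist1_trans_path_le (u' u : X → G) (U : X → X → G) (γ : ℕ → X) (n : ℕ) :
    dist1 (trans u' u (γ 0) * (trans u' u (γ n))⁻¹)
      ≤ ∑ i ∈ Finset.range n, (dist1 (rep u' U (γ i) (γ (i + 1))) + dist1 (rep u U (γ i) (γ (i + 1)))) :=
  (dist1_telescope (fun i => trans u' u (γ i)) n).trans
    (Finset.sum_le_sum fun i _ => dist1_trans_mul_inv_le u' u U (γ i) (γ (i + 1)))

/-- Uniform version: if both representatives are `≤ β′` resp. `≤ β` on the `n` pairs of the chain, then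
`∣w(γ₀) w(γₙ)⁻¹ − 1∣ ≤ n·(β′ + β)`.  With n ~ 2dMLʲ bonds across a cube of Theorem 1's class and β, β′ ~ η·B₃Mε₁(Lʲη)⁻¹
this is O(dB₃M²ε₁), NOT small with η: gluing two cube gauges by a CONSTANT is useless (HONEST SCOPE §3). [folklore] -/
theorem dist1_trans_path_le_const (u' u : X → G) (U : X → X → G) (γ : ℕ → X) (n : ℕ) (β' β : ℝ)
    (h' : ∀ i, i < n → dist1 (rep u' U (γ i) (γ (i + 1))) ≤ β')
    (h : ∀ i, i < n → dist1 (rep u U (γ i) (γ (i + 1))) ≤ β) :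
    dist1 (trans u' u (γ 0) * (trans u' u (γ n))⁻¹) ≤ n * (β' + β) :=
  dist1_telescope_const (fun i => trans u' u (γ i)) n (β' + β) fun i hi =>
    (dist1_trans_mul_inv_le u' u U (γ i) (γ (i + 1))).trans (add_le_add (h' i hi) (h i hi))

end Trans

/-! ## §4. Seam gluing by a retraction -/

section Glue

variable {X : Type*}

/-- The glued gauge: `glue u' v π x = u' x · w (π x)`, `w = trans u' v = u′⁻¹v` — the new gauge `u′` twisted by the
transition function to the old gauge `v` transported along the map `π` (a retraction onto the region where `v` is
kept). [folklore] -/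
def glue (u' v : X → G) (π : X → X) (x : X) : G := u' x * trans u' v (π x)

/-- Unfolding `glue`. [folklore] -/
theorem glue_apply (u' v : X → G) (π : X → X) (x : X) :
    glue u' v π x = u' x * ((u' (π x))⁻¹ * v (π x)) := rfl

/-- On the fixed points of `π` the glued gauge IS the old gauge: `π x = x → glue u' v π x = v x`. [folklore] -/
theorem glue_of_fix (u' v : X → G) (π : X → X) {x : X} (hx : π x = x) : glue u' v π x = v x := by
  simp [glue, trans, hx]

/-- The transition function from `u′` to the glued gauge is `w ∘ π`. [folklore] -/
theorem trans_glue (u' v : X → G) (π : X → X) : trans u' (glue u' v π) = trans u' v ∘ π := by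
  funext x; simp [trans, glue]

/-- With `π = id` nothing is glued: `glue u' v id = v`. [folklore] -/
theorem glue_id (u' v : X → G) : glue u' v id = v := by
  funext x; exact glue_of_fix u' v id rfl

/-- Representative of the glued gauge (exact): `rep (glue u' v π) U x y = w(πx)⁻¹ · rep u' U x y · w(πy)`.
[folklore] -/
theorem rep_glue (u' v : X → G) (π : X → X) (U : X → X → G) (x y : X) :
    rep (glue u' v π) U x y = (trans u' v (π x))⁻¹ * rep u' U x y * trans u' v (π y) := by
  simp only [rep, glue, trans]; group

/-- A pair with both endpoints fixed by `π` keeps the old representative EXACTLY. [folklore] -/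
theorem rep_glue_of_fix (u' v : X → G) (π : X → X) (U : X → X → G) {x y : X} (hx : π x = x) (hy : π y = y) :
    rep (glue u' v π) U x y = rep v U x y := by
  simp only [rep_apply, glue_of_fix u' v π hx, glue_of_fix u' v π hy]

/-- The seam bound, transition-function form: `∣rep ũ U x y − 1∣ ≤ ∣rep u' U x y − 1∣ + ∣w(πx) w(πy)⁻¹ − 1∣`.
[folklore] -/
theorem dist1_rep_glue_le (u' v : X → G) (π : X → X) (U : X → X → G) (x y : X) :
    dist1 (rep (glue u' v π) U x y)
      ≤ dist1 (rep u' U x y) + dist1 (trans u' v (π x) * (trans u' v (π y))⁻¹) := by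
  have h : rep (glue u' v π) U x y
      = ((trans u' v (π x))⁻¹ * rep u' U x y * trans u' v (π x))
        * ((trans u' v (π x))⁻¹ * trans u' v (π y)) := by
    rw [rep_glue]; group
  rw [h]
  refine (GaugeGroup.dist1_mul_le _ _).trans ?_
  rw [dist1_conj_inv, dist1_inv_mul_eq]

/-- THE SEAM BOUND (one formula, no case split): for every ordered pair,
`∣rep ũ U x y − 1∣ ≤ ∣rep u' U x y − 1∣ + ∣rep u' U (πx) (πy) − 1∣ + ∣rep v U (πx) (πy) − 1∣` — new-gauge size at
the pair, plus new- and old-gauge sizes at the LANDING pair `(πx, πy)`. [folklore] -/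
theorem dist1_rep_glue_le₃ (u' v : X → G) (π : X → X) (U : X → X → G) (x y : X) :
    dist1 (rep (glue u' v π) U x y)
      ≤ dist1 (rep u' U x y) + (dist1 (rep u' U (π x) (π y)) + dist1 (rep v U (π x) (π y))) :=
  (dist1_rep_glue_le u' v π U x y).trans (add_le_add le_rfl (dist1_trans_mul_inv_le u' v U (π x) (π y)))

/-- Where `π` collapses the pair (`π x = π y`) the seam term vanishes: `∣rep ũ U x y − 1∣ ≤ ∣rep u' U x y − 1∣`.
[folklore] -/
theorem dist1_rep_glue_of_collapse (u' v : X → G) (π : X → X) (U : X → X → G) {x y : X} (h : π x = π y) :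
    dist1 (rep (glue u' v π) U x y) ≤ dist1 (rep u' U x y) := by
  have := dist1_rep_glue_le u' v π U x y
  rwa [h, mul_inv_cancel, GaugeGroup.dist1_one, add_zero] at this

/-- THE GLUING SENTENCE with sup bounds (the form usable for G-adv9-7 / C-adv5-45 (2)): if the new gauge has
`∣rep u' U − 1∣ ≤ β′` on the pair set `S′` and the old gauge has `∣rep v U − 1∣ ≤ b` on `T`, then on every pair of `S′`
whose landing pair lies in `S′` and `T`, or collapses, the glued gauge has `∣rep ũ U − 1∣ ≤ 2β′ + b`; on pairs fixed
by `π` it keeps the old representative (`rep_glue_of_fix`). [folklore] -/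
theorem dist1_rep_glue_le_of_bounds (u' v : X → G) (π : X → X) (U : X → X → G)
    (S' T : X → X → Prop) (β' b : ℝ) (hβ' : 0 ≤ β') (hb : 0 ≤ b)
    (hS' : ∀ x y, S' x y → dist1 (rep u' U x y) ≤ β')
    (hT : ∀ x y, T x y → dist1 (rep v U x y) ≤ b)
    (x y : X) (hxy : S' x y) (hπ : (S' (π x) (π y) ∧ T (π x) (π y)) ∨ π x = π y) :
    dist1 (rep (glue u' v π) U x y) ≤ 2 * β' + b := by
  rcases hπ with ⟨hS, hTT⟩ | hc
  · calc dist1 (rep (glue u' v π) U x y)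
          ≤ dist1 (rep u' U x y) + (dist1 (rep u' U (π x) (π y)) + dist1 (rep v U (π x) (π y))) :=
            dist1_rep_glue_le₃ u' v π U x y
      _ ≤ β' + (β' + b) := add_le_add (hS' x y hxy) (add_le_add (hS' _ _ hS) (hT _ _ hTT))
      _ = 2 * β' + b := by ring
  · calc dist1 (rep (glue u' v π) U x y) ≤ dist1 (rep u' U x y) := dist1_rep_glue_of_collapse u' v π U hc
      _ ≤ β' := hS' x y hxy
      _ ≤ 2 * β' + b := by linarith

end Glue

/-! ## §5. Chains of gluings -/

section Chain

variable {X : Type*}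

/-- The chain of glued gauges: `ũ₀ = u₀`, `ũₙ₊₁ = glue uₙ₊₁ ũₙ πₙ` (stage n+1 keeps `ũₙ` on `Fix πₙ` and extends by the
new cube's gauge `uₙ₊₁`). [folklore] -/
def chainGauge (u : ℕ → X → G) (π : ℕ → X → X) : ℕ → X → G
  | 0 => u 0
  | n + 1 => glue (u (n + 1)) (chainGauge u π n) (π n)

/-- The controlled pair sets of the chain: stage 0 = `S 0`; stage n+1 = the pairs fixed by `πₙ` that were controlled
at stage n, together with the pairs of `S (n+1)` whose `πₙ`-image is in `S (n+1)` and controlled at stage n, or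
collapses. [folklore] -/
def chainCtrl (S : ℕ → X → X → Prop) (π : ℕ → X → X) : ℕ → X → X → Prop
  | 0 => S 0
  | n + 1 => fun x y =>
      (π n x = x ∧ π n y = y ∧ chainCtrl S π n x y) ∨
      (S (n + 1) x y ∧
        ((S (n + 1) (π n x) (π n y) ∧ chainCtrl S π n (π n x) (π n y)) ∨ π n x = π n y))

/-- The chain bounds: `b₀ = β₀`, `bₙ₊₁ = bₙ + 2βₙ₊₁`. [folklore] -/
def chainBound (β : ℕ → ℝ) : ℕ → ℝ
  | 0 => β 0
  | n + 1 => chainBound β n + 2 * β (n + 1)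

/-- Unfolding, stage 0. [folklore] -/
@[simp] theorem chainGauge_zero (u : ℕ → X → G) (π : ℕ → X → X) : chainGauge u π 0 = u 0 := rfl

/-- Unfolding, successor stage. [folklore] -/
@[simp] theorem chainGauge_succ (u : ℕ → X → G) (π : ℕ → X → X) (n : ℕ) :
    chainGauge u π (n + 1) = glue (u (n + 1)) (chainGauge u π n) (π n) := rfl

/-- Unfolding, stage 0. [folklore] -/
@[simp] theorem chainCtrl_zero (S : ℕ → X → X → Prop) (π : ℕ → X → X) : chainCtrl S π 0 = S 0 := rfl

/-- Unfolding, successor stage. [folklore] -/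
theorem chainCtrl_succ (S : ℕ → X → X → Prop) (π : ℕ → X → X) (n : ℕ) (x y : X) :
    chainCtrl S π (n + 1) x y ↔
      (π n x = x ∧ π n y = y ∧ chainCtrl S π n x y) ∨
      (S (n + 1) x y ∧
        ((S (n + 1) (π n x) (π n y) ∧ chainCtrl S π n (π n x) (π n y)) ∨ π n x = π n y)) := Iff.rfl

/-- Unfolding, stage 0. [folklore] -/
@[simp] theorem chainBound_zero (β : ℕ → ℝ) : chainBound β 0 = β 0 := rfl

/-- Unfolding, successor stage. [folklore] -/
@[simp] theorem chainBound_succ (β : ℕ → ℝ) (n : ℕ) :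
    chainBound β (n + 1) = chainBound β n + 2 * β (n + 1) := rfl

/-- Closed form: `bₙ = β₀ + 2 Σ_{i=1}^{n} βᵢ`. [folklore] -/
theorem chainBound_eq_sum (β : ℕ → ℝ) (n : ℕ) :
    chainBound β n = β 0 + 2 * ∑ i ∈ Finset.range n, β (i + 1) := by
  induction n with
  | zero => simp
  | succ n ih => rw [chainBound_succ, ih, Finset.sum_range_succ]; ring

/-- The chain bounds are nonnegative for nonnegative `β`. [folklore] -/
theorem chainBound_nonneg (β : ℕ → ℝ) (hβ : ∀ n, 0 ≤ β n) (n : ℕ) : 0 ≤ chainBound β n := by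
  induction n with
  | zero => simpa using hβ 0
  | succ n ih => rw [chainBound_succ]; linarith [hβ (n + 1)]

/-- The chain bounds are monotone for nonnegative `β`. [folklore] -/
theorem chainBound_mono (β : ℕ → ℝ) (hβ : ∀ n, 0 ≤ β n) {i n : ℕ} (hin : i ≤ n) :
    chainBound β i ≤ chainBound β n := by
  induction n, hin using Nat.le_induction with
  | base => exact le_rfl
  | succ n _ ih => rw [chainBound_succ]; linarith [hβ (n + 1)]

/-- THE CHAIN THEOREM: if stage n's gauge `uₙ` has `∣rep uₙ U − 1∣ ≤ βₙ` on `Sₙ` (all `βₙ ≥ 0`), then the glued gauge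
`ũₙ` has `∣rep ũₙ U − 1∣ ≤ bₙ = β₀ + 2Σ_{1≤i≤n} βᵢ` on the controlled pairs of stage n. [folklore] -/
theorem chain_bound (u : ℕ → X → G) (π : ℕ → X → X) (U : X → X → G) (S : ℕ → X → X → Prop) (β : ℕ → ℝ)
    (hβ : ∀ n, 0 ≤ β n) (hS : ∀ n x y, S n x y → dist1 (rep (u n) U x y) ≤ β n) :
    ∀ n x y, chainCtrl S π n x y → dist1 (rep (chainGauge u π n) U x y) ≤ chainBound β n := by
  intro n
  induction n with
  | zero => intro x y h; exact hS 0 x y h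
  | succ n ih =>
    intro x y h
    rw [chainCtrl_succ] at h
    rw [chainGauge_succ, chainBound_succ]
    rcases h with ⟨hx, hy, hT⟩ | ⟨hS1, hrest⟩
    · rw [rep_glue_of_fix (u (n + 1)) (chainGauge u π n) (π n) U hx hy]
      linarith [ih x y hT, hβ (n + 1)]
    · have := dist1_rep_glue_le_of_bounds (u (n + 1)) (chainGauge u π n) (π n) U (S (n + 1))
        (chainCtrl S π n) (β (n + 1)) (chainBound β n) (hβ _) (chainBound_nonneg β hβ n) (hS (n + 1)) ih
        x y hS1 hrest
      linarith

/-- PERSISTENCE (values): a site fixed by every `πₘ`, `i ≤ m < n`, keeps its stage-i gauge value exactly.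
[folklore] -/
theorem chainGauge_of_fix (u : ℕ → X → G) (π : ℕ → X → X) {i n : ℕ} (hin : i ≤ n) {x : X}
    (hfix : ∀ m, i ≤ m → m < n → π m x = x) :
    chainGauge u π n x = chainGauge u π i x := by
  induction n, hin using Nat.le_induction with
  | base => rfl
  | succ n hin ih =>
    rw [chainGauge_succ, glue_of_fix _ _ _ (hfix n hin (Nat.lt_succ_self n))]
    exact ih fun m hm hmn => hfix m hm (Nat.lt_succ_of_lt hmn)

/-- PERSISTENCE (pairs): a pair whose endpoints are fixed by every `πₘ`, `i ≤ m < n`, keeps its stage-i representative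
exactly — so a pair first controlled at stage i carries the bound `bᵢ` at every later stage, not `bₙ`. [folklore] -/
theorem chainGauge_rep_of_fix (u : ℕ → X → G) (π : ℕ → X → X) (U : X → X → G) {i n : ℕ} (hin : i ≤ n)
    {x y : X} (hfix : ∀ m, i ≤ m → m < n → π m x = x ∧ π m y = y) :
    rep (chainGauge u π n) U x y = rep (chainGauge u π i) U x y := by
  simp only [rep_apply, chainGauge_of_fix u π hin (fun m hm hmn => (hfix m hm hmn).1),
    chainGauge_of_fix u π hin (fun m hm hmn => (hfix m hm hmn).2)]

/-- Geometric growth `L·βᵢ ≤ βᵢ₊₁` with `1 < L` from a nonnegative start is monotone: `β₀ ≤ βₙ` (and hence all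
`βₙ ≥ 0`). [folklore] -/
theorem le_of_geometric_growth (β : ℕ → ℝ) (L : ℝ) (hL : 1 < L) (hβ0 : 0 ≤ β 0)
    (hgrow : ∀ i, L * β i ≤ β (i + 1)) : ∀ n, β 0 ≤ β n := by
  intro n
  induction n with
  | zero => exact le_rfl
  | succ n ih =>
    have hβn : 0 ≤ β n := hβ0.trans ih
    have : β n ≤ β (n + 1) := by nlinarith [hgrow n]
    exact ih.trans this

/-- RADIAL REGIME (coarse → fine), the geometric sum: if `0 ≤ β₀` and `L·βᵢ ≤ βᵢ₊₁` for all `i` with `1 < L`, then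
`Σ_{i=1}^{n} βᵢ ≤ (L/(L−1))·βₙ`. [folklore] -/
theorem sum_le_of_geometric_growth (β : ℕ → ℝ) (L : ℝ) (hL : 1 < L) (hβ0 : 0 ≤ β 0)
    (hgrow : ∀ i, L * β i ≤ β (i + 1)) (n : ℕ) :
    ∑ i ∈ Finset.range n, β (i + 1) ≤ L / (L - 1) * β n := by
  have hL1 : 0 < L - 1 := by linarith
  have hLne : L ≠ 0 := ne_of_gt (by linarith)
  have hL1ne : L - 1 ≠ 0 := ne_of_gt hL1
  have hK : 0 ≤ L / (L - 1) := div_nonneg (by linarith) hL1.le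
  induction n with
  | zero => simpa using mul_nonneg hK hβ0
  | succ n ih =>
    rw [Finset.sum_range_succ]
    have h0 : β n ≤ β (n + 1) / L := by
      rw [le_div_iff₀ (by linarith)]; linarith [hgrow n]
    have h1 : L / (L - 1) * β n ≤ L / (L - 1) * (β (n + 1) / L) := mul_le_mul_of_nonneg_left h0 hK
    have h2 : L / (L - 1) * (β (n + 1) / L) + β (n + 1) = L / (L - 1) * β (n + 1) := by
      field_simp
      ring
    linarith

/-- RADIAL REGIME, the k-uniform bound: under geometric growth `L·βᵢ ≤ βᵢ₊₁`, `1 < L`, `0 ≤ β₀`, the chain bound of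
stage n is `≤ β₀ + 2(L/(L−1))·βₙ ≤ (1 + 2L/(L−1))·βₙ` — every layer carries O(1) times ITS OWN bound, O(1)
independent of n (≤ 5 for L ≥ 2). [folklore] -/
theorem chainBound_le_of_geometric_growth (β : ℕ → ℝ) (L : ℝ) (hL : 1 < L) (hβ0 : 0 ≤ β 0)
    (hgrow : ∀ i, L * β i ≤ β (i + 1)) (n : ℕ) :
    chainBound β n ≤ β 0 + 2 * (L / (L - 1) * β n) ∧
      chainBound β n ≤ (1 + 2 * (L / (L - 1))) * β n := by
  have hsum := sum_le_of_geometric_growth β L hL hβ0 hgrow n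
  have hmono := le_of_geometric_growth β L hL hβ0 hgrow n
  rw [chainBound_eq_sum]
  constructor
  · linarith
  · linarith

/-- TANGENTIAL REGIME: a chain of cubes of ONE scale (`βᵢ ≡ β`) accumulates LINEARLY, `bₙ = (2n + 1)·β`. [folklore] -/
theorem chainBound_const (β₀ : ℝ) (n : ℕ) : chainBound (fun _ => β₀) n = (2 * n + 1) * β₀ := by
  rw [chainBound_eq_sum]; simp; ring

end Chain

/-! ## §6. A concrete retraction: the coordinatewise clamp into a box of ℤᵈ -/

section Clamp

variable {d : ℕ}

/-- The coordinatewise clamp into the box `[lo, hi] ⊂ ℤᵈ`: `clamp lo hi x i = max (lo i) (min (x i) (hi i))`.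
[folklore] -/
def clamp (lo hi x : Fin d → ℤ) : Fin d → ℤ := fun i => max (lo i) (min (x i) (hi i))

/-- Membership in the box `[lo, hi]`. [folklore] -/
def InBox (lo hi x : Fin d → ℤ) : Prop := ∀ i, lo i ≤ x i ∧ x i ≤ hi i

/-- Unfolding `clamp`. [folklore] -/
theorem clamp_apply (lo hi x : Fin d → ℤ) (i : Fin d) : clamp lo hi x i = max (lo i) (min (x i) (hi i)) := rfl

/-- The clamp lands in the box (for a genuine box `lo ≤ hi`). [folklore] -/
theorem clamp_mem (lo hi : Fin d → ℤ) (hbox : ∀ i, lo i ≤ hi i) (x : Fin d → ℤ) :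
    InBox lo hi (clamp lo hi x) := by
  intro i
  refine ⟨le_max_left _ _, max_le (hbox i) (min_le_right _ _)⟩

/-- The clamp is the identity on the box (π = id on the kept region). [folklore] -/
theorem clamp_of_mem (lo hi x : Fin d → ℤ) (hx : InBox lo hi x) : clamp lo hi x = x := by
  funext i
  rw [clamp_apply, min_eq_left (hx i).2, max_eq_right (hx i).1]

/-- The clamp is idempotent (a retraction onto the box). [folklore] -/
theorem clamp_clamp (lo hi : Fin d → ℤ) (hbox : ∀ i, lo i ≤ hi i) (x : Fin d → ℤ) :
    clamp lo hi (clamp lo hi x) = clamp lo hi x :=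
  clamp_of_mem lo hi _ (clamp_mem lo hi hbox x)

/-- Equal coordinates stay equal. [folklore] -/
theorem clamp_coord_eq (lo hi x y : Fin d → ℤ) {i : Fin d} (h : x i = y i) :
    clamp lo hi x i = clamp lo hi y i := by
  rw [clamp_apply, clamp_apply, h]

/-- The clamp is monotone in every coordinate. [folklore] -/
theorem clamp_mono_coord (lo hi x y : Fin d → ℤ) {i : Fin d} (h : x i ≤ y i) :
    clamp lo hi x i ≤ clamp lo hi y i :=
  max_le_max le_rfl (min_le_min h le_rfl)

/-- The clamp is 1-Lipschitz in every coordinate: `∣clamp x i − clamp y i∣ ≤ ∣x i − y i∣`. [folklore] -/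
theorem abs_clamp_sub_le (lo hi x y : Fin d → ℤ) (i : Fin d) :
    |clamp lo hi x i - clamp lo hi y i| ≤ |x i - y i| := by
  rw [clamp_apply, clamp_apply]
  calc |max (lo i) (min (x i) (hi i)) - max (lo i) (min (y i) (hi i))|
        ≤ max |lo i - lo i| |min (x i) (hi i) - min (y i) (hi i)| := abs_max_sub_max_le_max _ _ _ _
    _ = |min (x i) (hi i) - min (y i) (hi i)| := by rw [sub_self, abs_zero, max_eq_right (abs_nonneg _)]
    _ ≤ max |x i - y i| |hi i - hi i| := abs_min_sub_min_le_max _ _ _ _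
    _ = |x i - y i| := by rw [sub_self, abs_zero, max_eq_left (abs_nonneg _)]

/-- Lattice neighbours: `y = x + e_μ`. [folklore] -/
def Nbr (x y : Fin d → ℤ) : Prop := ∃ μ : Fin d, y = Function.update x μ (x μ + 1)

/-- A lattice bond `(x, x + e_μ)` is mapped by the clamp to a lattice bond of the box or COLLAPSED to a point — so for a
box-shaped kept region the landing pair of a bond is a bond or a point, as §4 requires. [folklore] -/
theorem clamp_nbr (lo hi x y : Fin d → ℤ) (h : Nbr x y) :
    clamp lo hi x = clamp lo hi y ∨ Nbr (clamp lo hi x) (clamp lo hi y) := by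
  obtain ⟨μ, rfl⟩ := h
  have hoff : ∀ i, i ≠ μ → clamp lo hi x i = clamp lo hi (Function.update x μ (x μ + 1)) i := by
    intro i hne
    exact clamp_coord_eq lo hi _ _ (by rw [Function.update_of_ne hne])
  have hle : clamp lo hi x μ ≤ clamp lo hi (Function.update x μ (x μ + 1)) μ :=
    clamp_mono_coord lo hi _ _ (by rw [Function.update_self]; linarith)
  have hlip : |clamp lo hi x μ - clamp lo hi (Function.update x μ (x μ + 1)) μ| ≤ 1 := by
    have := abs_clamp_sub_le lo hi x (Function.update x μ (x μ + 1)) μ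
    rwa [Function.update_self, show x μ - (x μ + 1) = -1 by ring, abs_neg, abs_one] at this
  have hcases : clamp lo hi (Function.update x μ (x μ + 1)) μ = clamp lo hi x μ ∨
      clamp lo hi (Function.update x μ (x μ + 1)) μ = clamp lo hi x μ + 1 := by
    rw [abs_le] at hlip
    rcases hlip with ⟨h1, _⟩
    omega
  rcases hcases with h0 | h1
  · left
    funext i
    by_cases hiμ : i = μ
    · subst hiμ; exact h0.symm
    · exact hoff i hiμ
  · right
    refine ⟨μ, ?_⟩
    funext i
    by_cases hiμ : i = μ
    · subst hiμ; rw [Function.update_self, h1]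
    · rw [Function.update_of_ne hiμ]; exact (hoff i hiμ).symm

end Clamp

end Literature.MathematicalPhysics.QuantumFieldTheory.Balaban1983to89.B11GaugeGlue
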